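import Literature.Geometry.Kaehler.ComplexTorusTranscendentalLatticeIsogenyIndex
import HarnessLib

/-!
# The transcendental lattice under an isogeny — pull-back AND Gysin: `f^*(f_! x) = det ρ_r(f) · x`, `[T_{X′} : f_! T_X]` is finite, and
# the INDEX PRODUCT `[T_X : f^* T_{X′}] · [T_{X′} : f_! T_X] = |det ρ_r(f)|^{rk T}`

Layer `Literature/Geometry/Kaehler`, namespace `Literature.Geometry.Kaehler.ComplexTorus`; lane `lit-hodgefound` (Track 2
foundations library), seat p09, generation 34, row g34-#3. THEOREMS ONLY (0 definitions); no named fact, net debt 0. Sequel of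
g34-#2 `ComplexTorusTranscendentalLatticeIsogenyIndex` (`[T_X : f^* T_{X′}]` finite, dividing `e(f)^{l·rk T}`, `f^* T′` inside `T` = range
of g31-#12's injective `f^*|_{T′}`) and of g33-#4 `ComplexTorusTranscendentalLatticeGysin` (the integral GYSIN image along `f = ρ(A)`, in
adjunction form `⟨β, f_! x⟩_{X′} = ⟨f^* β, x⟩_X` for all `β`, `f_! T ⊆ T′` as a `ℤ`-linear map `f_!|_T : T_X → T_{X′}`
(`exists_intLinearMap_integralHodgeAnnihilator_gysin`), `f_! f^* = det ρ_r(f)`), for the degree-`l` transcendental lattice of g31-#11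

  `T = Hˡ(X, ℤ) ∩ ⋂_{s ∈ Hdg^{k,p}(X, ℤ)} ker ⟨s, ·⟩ = integralForms Φ l ⊓ ⨅ s, (ker (poincarePairing Φ e h s)).toAddSubgroup`   (`k + l = |ι|`)

along an ISOGENY `f = ρ(A) : X = E/Φ(ℤ^ι) → X′ = E′/Φ′(ℤ^{ι′})` of tori of the same dimension (`|ι| = |ι′| = n`). The Gysin map is
taken, as in g33-#4, in hypothesis form: any `ℤ`-linear `G : T_X → T_{X′}` with `⟨β, G x⟩_{e′} = ⟨f^*β, x⟩_e` for all `β ∈ Hᵏ(X′, ℂ)`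
(it exists and is unique by g33-#4; `f_! T_X` is its range).

* §1 **`f^*(f_! x) = det(A_{ẽ′ẽ}) · x`** for an isogeny and ANY `x ∈ Hˡ(X, ℂ)` (Bredon VI.14.1 (7) "`f^* f^! = deg f`", Fulton 1.7.4
  "`f_* f^* = d`, the composite `A_*X → A_*X′ → A_*X` is multiplication by `d`"; the tree had `f_! f^* = det`, g33-#4, and the rational
  `gysinMap` version `IsIsogeny.pullbackForms_gysinMap`): pair `f^*(f_! x) − det · x` with `f^*(g^*γ) = e(f)ᵏ · γ` for the quasi-inverse `g`.
* §2 the pure lattice algebra: for free `T` of finite rank, `R : T′ ↪ T` injective and `G : T → T′` with `R ∘ G = d · id`,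
  **`[T : R T′] · [T′ : G T] = |d|^{rk T}`** (Mathlib's `AddSubgroup.index_map_of_injective`, `AddSubgroup.index_range_nsmul`).
* §3 for an isogeny and every bidegree: **`[T_X : f^* T_{X′}] · [T_{X′} : f_! T_X] = |det(A_{ẽ′ẽ})|^{rk T}`**, hence `[T_{X′} : f_! T_X]`
  is finite (non-zero) and divides `|det|^{rk T}`, `f_!|_T` is injective, and **`f_! T_X = T_{X′}` iff `[T_X : f^* T_{X′}] = |det|^{rk T}`**
  (the transcendental companion of p35's `index_range_integralHodgeClassesPullbackHom_mul_gysinHom` for `Hdg`).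

## References

* [cite: VoisinHodgeI2002, §7.3.2 Remark 7.29 (PDF p. 150: "`φ_* ∘ φ^* = d Id`", `φ^*` injective) and PDF p. 151 (`(φ_*α, β) = (α, φ^*β)`)]
* [cite: Bredon1993, Ch. VI §14 Prop. 14.1 (6) `f^! f^* = deg(f)`, (7) `f^* f^! = deg(f)` on im `f^*` (p. 402)]
* [cite: Fulton1998, Example 1.7.4 (p. 31: "`f_*f^*[V] = d[V]` … the composite is multiplication by `d`")]
* [cite: Lange2023AbelianVarietiesComplex, §1.1.2 Prop. 1.1.13 (c), Prop. 1.1.15 (PDF p. 22); §1.7.2 Cor. 1.7.6 (proof); §6.2.4 (p. 310)]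
* [cite: Huybrechts2016K3, Ch. 14 §0.1 (PDF p. 333: finite-index sublattices)]
-/

noncomputable section

open Module Function

namespace Literature.Geometry.Kaehler.ComplexTorus

/-! ## §2 (lattice algebra) `[T : R T′] · [T′ : G T] = |d|^{rk T}` when `R` is injective and `R ∘ G = d` -/

section LatticeAlgebra

/-- **`[M : R N] · [N : G M] = |d|^{rk M}`** for a free abelian group `M` of finite rank, an INJECTIVE additive `R : N → M` and an additive
`G : M → N` with `R (G x) = d · x`: `R` carries `G M ⊆ N` onto `d · M ⊆ R N ⊆ M`, and `[M : d · M] = |d|^{rk M}` (Mathlib's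
`AddSubgroup.index_range_nsmul`), `[M : R(G M)] = [N : G M] · [M : R N]` (`AddSubgroup.index_map_of_injective`).
[cite: Huybrechts2016K3, Ch. 14 §0.1 (PDF p. 333)] [cite: Fulton1998, Example 1.7.4 (p. 31)] -/
theorem index_range_mul_index_range_eq_natAbs_pow_of_comp_eq_smul {M N : Type*} [AddCommGroup M] [AddCommGroup N]
    [Module.Free ℤ M] [Module.Finite ℤ M] (R : N →ₗ[ℤ] M) (G : M →ₗ[ℤ] N) (hR : Injective R) (d : ℤ)
    (hRG : ∀ x, R (G x) = d • x) :
    (LinearMap.range R).toAddSubgroup.index * (LinearMap.range G).toAddSubgroup.index = d.natAbs ^ finrank ℤ M := by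
  -- `R(G M) = d · M = |d| · M`
  have hmap : ((LinearMap.range G).toAddSubgroup).map R.toAddMonoidHom = (nsmulAddMonoidHom (α := M) d.natAbs).range := by
    ext x
    simp only [AddSubgroup.mem_map, Submodule.mem_toAddSubgroup, LinearMap.mem_range, AddMonoidHom.mem_range,
      LinearMap.toAddMonoidHom_coe, nsmulAddMonoidHom_apply]
    constructor
    · rintro ⟨_, ⟨y, rfl⟩, rfl⟩
      rw [hRG]
      rcases Int.natAbs_eq d with hd | hd
      · exact ⟨y, by rw [← natCast_zsmul, ← hd]⟩
      · exact ⟨-y, by rw [← natCast_zsmul, smul_neg, ← neg_smul, ← hd]⟩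
    · rintro ⟨y, rfl⟩
      rcases Int.natAbs_eq d with hd | hd
      · exact ⟨G y, ⟨y, rfl⟩, by rw [hRG, ← natCast_zsmul, ← hd]⟩
      · exact ⟨G (-y), ⟨-y, rfl⟩, by rw [hRG, smul_neg, ← neg_smul, neg_eq_iff_eq_neg.2 hd, natCast_zsmul]⟩
  have h1 := AddSubgroup.index_map_of_injective (H := (LinearMap.range G).toAddSubgroup) (f := R.toAddMonoidHom) hR
  rw [hmap, AddSubgroup.index_range_nsmul] at h1
  rw [mul_comm]
  convert h1.symm using 2
  rw [LinearMap.range_toAddSubgroup]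

end LatticeAlgebra

section GysinIndex

variable {ι ι' : Type*} [Fintype ι] [Fintype ι'] [DecidableEq ι] [DecidableEq ι']
  {E E' : Type*} [NormedAddCommGroup E] [NormedSpace ℂ E] [NormedAddCommGroup E'] [NormedSpace ℂ E']
  (Φ : (ι → ℝ) ≃L[ℝ] E) (Φ' : (ι' → ℝ) ≃L[ℝ] E') {n k l : ℕ} (e : Fin n ≃ ι) (e' : Fin n ≃ ι') (h : k + l = n) (p : ℕ)

/-! ## §1 `f^*(f_! x) = det(A_{ẽ′ẽ}) · x` for an isogeny -/

omit [Fintype ι'] [DecidableEq ι'] in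
/-- `det(A_{ẽ′ẽ}) ≠ 0` for an isogeny (`|det(A_{ẽ′ẽ})| = #Ker f > 0`, Lange Prop. 1.1.13 through the tree's
`natCard_ker_mapMatrixHom_eq_natAbs_det_submatrix`). [cite: Lange2023AbelianVarietiesComplex, §1.1.2 Prop. 1.1.13 (a), (c) (PDF p. 22)] -/
private theorem IsIsogeny.det_submatrix_finCongr_ne_zero {A : Matrix ι' ι ℤ} (hf : IsIsogeny Φ Φ' A) :
    (A.submatrix ((finCongr h).trans e') ((finCongr h).trans e)).det ≠ 0 := by
  haveI := hf.finite_ker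
  have h1 : 0 < Nat.card (mapMatrixHom Φ Φ' A).ker := Nat.card_pos
  rw [natCard_ker_mapMatrixHom_eq_natAbs_det_submatrix Φ Φ' A (((finCongr h).trans e).symm.trans ((finCongr h).trans e'))] at h1
  have h2 : A.submatrix ((finCongr h).trans e') ((finCongr h).trans e) =
      (A.submatrix (((finCongr h).trans e).symm.trans ((finCongr h).trans e')) id).submatrix
        ((finCongr h).trans e) ((finCongr h).trans e) := by
    ext i j
    simp only [Matrix.submatrix_apply, id_eq, Equiv.trans_apply, Equiv.symm_trans_apply, Equiv.symm_apply_apply]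
  rw [h2, Matrix.det_submatrix_equiv_self]
  exact Int.natAbs_ne_zero.1 h1.ne'

/-- **`f^*(f_! x) = det(A_{ẽ′ẽ}) · x` for an isogeny `f = ρ(A) : X → X′`** of tori of the same dimension, `x ∈ Hˡ(X, ℂ)` arbitrary and
`x′ = f_! x` its Gysin image in adjunction form (`⟨β, x′⟩_{e′} = ⟨f^*β, x⟩_e` for all `β ∈ Hᵏ(X′, ℂ)`): pairing `f^*x′ − det · x`
against `f^*(g^*γ) = e(f)ᵏ · γ` (`g` the quasi-inverse isogeny, `gf = e_X`, Prop. 1.1.15) gives `det · ⟨g^*γ, x′⟩ − det · ⟨f^*g^*γ, x⟩ = 0`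
(g31-#12 `⟨f^*β, f^*y⟩ = det · ⟨β, y⟩`), and the cup product is non-degenerate. Companion of g33-#4's `f_! f^* = det`
(`eq_det_smul_of_forall_poincarePairing_eq_comp_realRep`). [cite: Bredon1993, Ch. VI §14 Prop. 14.1 (7) (p. 402)] [cite: VoisinHodgeI2002, §7.3.2 Remark 7.29 (PDF p. 150)] [cite: Lange2023AbelianVarietiesComplex, §1.1.2 Prop. 1.1.15 (PDF p. 22)] -/
theorem IsIsogeny.comp_realRep_eq_det_smul_of_forall_poincarePairing_eq_comp_realRep {A : Matrix ι' ι ℤ} (hf : IsIsogeny Φ Φ' A)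
    {x : E [⋀^Fin l]→L[ℝ] ℂ} {x' : E' [⋀^Fin l]→L[ℝ] ℂ}
    (hx' : ∀ β : E' [⋀^Fin k]→L[ℝ] ℂ, poincarePairing Φ' e' h β x' =
      poincarePairing Φ e h (β.compContinuousLinearMap (realRep Φ Φ' A)) x) :
    x'.compContinuousLinearMap (realRep Φ Φ' A) = ((A.submatrix ((finCongr h).trans e') ((finCongr h).trans e)).det : ℂ) • x := by
  obtain ⟨Bq, -, hBqA, -⟩ := hf.exists_quasiInverse
  have hN : ((AddMonoid.exponent (mapMatrixHom Φ Φ' A).ker : ℂ) ^ k) ≠ 0 :=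
    pow_ne_zero _ (Nat.cast_ne_zero.2 hf.exponent_ker_pos.ne')
  rw [← sub_eq_zero]
  refine eq_zero_of_forall_left_poincarePairing_eq_zero Φ e h fun γ ↦ ?_
  -- `f^*(g^*γ) = eᵏ · γ`
  have hγ : (γ.compContinuousLinearMap (realRep Φ' Φ Bq)).compContinuousLinearMap (realRep Φ Φ' A) =
      ((AddMonoid.exponent (mapMatrixHom Φ Φ' A).ker : ℂ) ^ k) • γ := by
    have hc : (γ.compContinuousLinearMap (realRep Φ' Φ Bq)).compContinuousLinearMap (realRep Φ Φ' A) =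
        γ.compContinuousLinearMap ((realRep Φ' Φ Bq).comp (realRep Φ Φ' A)) := by
      ext v; rfl
    rw [hc, realRep_mul, hBqA, comp_realRep_smul_one, Int.cast_natCast]
  have h1 := poincarePairing_comp_realRep_comp_realRep Φ Φ' e e' h A (γ.compContinuousLinearMap (realRep Φ' Φ Bq)) x'
  rw [hx', hγ] at h1
  simp only [map_smul, LinearMap.smul_apply, smul_eq_mul] at h1
  -- `h1 : eᵏ ⟨γ, f^*x′⟩ = det · eᵏ ⟨γ, x⟩`
  have h2 : poincarePairing Φ e h γ (x'.compContinuousLinearMap (realRep Φ Φ' A)) =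
      ((A.submatrix ((finCongr h).trans e') ((finCongr h).trans e)).det : ℂ) * poincarePairing Φ e h γ x :=
    mul_left_cancel₀ hN (by rw [h1]; ring)
  rw [map_sub, map_smul, smul_eq_mul, h2, sub_self]

/-- **`f^* ∘ f_!|_T = det(A_{ẽ′ẽ}) · id_T` on the transcendental lattice**: for g31-#12's `R = f^*|_{T′} : T_{X′} → T_X` and any Gysin
`G = f_!|_T : T_X → T_{X′}` (adjunction form, g33-#4), `R (G t) = det · t`. [cite: Bredon1993, Ch. VI §14 Prop. 14.1 (7)] [cite: VoisinHodgeI2002, §7.3.2 Remark 7.29] -/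
theorem IsIsogeny.pullback_gysin_apply_eq_det_smul {A : Matrix ι' ι ℤ} (hf : IsIsogeny Φ Φ' A)
    (R : ↥(integralForms Φ' l ⊓ ⨅ s : integralHodgeClassesIn Φ' k p,
          (LinearMap.ker (poincarePairing Φ' e' h (s : E' [⋀^Fin k]→L[ℝ] ℂ))).toAddSubgroup) →ₗ[ℤ]
        ↥(integralForms Φ l ⊓ ⨅ s : integralHodgeClassesIn Φ k p,
          (LinearMap.ker (poincarePairing Φ e h (s : E [⋀^Fin k]→L[ℝ] ℂ))).toAddSubgroup))
    (hR : ∀ t, (R t : E [⋀^Fin l]→L[ℝ] ℂ) = (t : E' [⋀^Fin l]→L[ℝ] ℂ).compContinuousLinearMap (realRep Φ Φ' A))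
    (G : ↥(integralForms Φ l ⊓ ⨅ s : integralHodgeClassesIn Φ k p,
          (LinearMap.ker (poincarePairing Φ e h (s : E [⋀^Fin k]→L[ℝ] ℂ))).toAddSubgroup) →ₗ[ℤ]
        ↥(integralForms Φ' l ⊓ ⨅ s : integralHodgeClassesIn Φ' k p,
          (LinearMap.ker (poincarePairing Φ' e' h (s : E' [⋀^Fin k]→L[ℝ] ℂ))).toAddSubgroup))
    (hG : ∀ x (β : E' [⋀^Fin k]→L[ℝ] ℂ), poincarePairing Φ' e' h β (G x : E' [⋀^Fin l]→L[ℝ] ℂ) =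
      poincarePairing Φ e h (β.compContinuousLinearMap (realRep Φ Φ' A)) (x : E [⋀^Fin l]→L[ℝ] ℂ))
    (t : ↥(integralForms Φ l ⊓ ⨅ s : integralHodgeClassesIn Φ k p,
          (LinearMap.ker (poincarePairing Φ e h (s : E [⋀^Fin k]→L[ℝ] ℂ))).toAddSubgroup)) :
    R (G t) = (A.submatrix ((finCongr h).trans e') ((finCongr h).trans e)).det • t := by
  apply Subtype.ext
  rw [hR, AddSubgroupClass.coe_zsmul, ← Int.cast_smul_eq_zsmul ℂ]
  exact hf.comp_realRep_eq_det_smul_of_forall_poincarePairing_eq_comp_realRep Φ Φ' e e' h (hG t)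

/-! ## §3 The index product `[T_X : f^* T_{X′}] · [T_{X′} : f_! T_X] = |det(A_{ẽ′ẽ})|^{rk T}` -/

/-- **THE INDEX PRODUCT `[T_X : f^* T_{X′}] · [T_{X′} : f_! T_X] = |det(A_{ẽ′ẽ})|^{rk T_X}`** for an isogeny `f = ρ(A)` and every
bidegree `(k, l)`: here `f^* T_{X′} = T′.map (pullbackAlt (realRep Φ Φ′ A) l)` (g34-#2; its relative index in `T_X`) and `f_! T_X` is the
range of any Gysin map `G : T_X → T_{X′}` in adjunction form (g33-#4 `exists_intLinearMap_integralHodgeAnnihilator_gysin`; its index in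
`T_{X′}`). (`|det(A_{ẽ′ẽ})| = deg f = #Ker f`.) The `Hdg`-companion is p35's `index_range_integralHodgeClassesPullbackHom_mul_gysinHom`.
[cite: Bredon1993, Ch. VI §14 Prop. 14.1 (6)–(7) (p. 402)] [cite: Fulton1998, Example 1.7.4 (p. 31)] [cite: VoisinHodgeI2002, §7.3.2 Remark 7.29 (PDF p. 150)] [cite: Lange2023AbelianVarietiesComplex, §1.1.2 Prop. 1.1.13 (c) (PDF p. 22)] -/
theorem IsIsogeny.relIndex_map_pullbackAlt_mul_index_range_gysin_eq {A : Matrix ι' ι ℤ} (hf : IsIsogeny Φ Φ' A)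
    (G : ↥(integralForms Φ l ⊓ ⨅ s : integralHodgeClassesIn Φ k p,
          (LinearMap.ker (poincarePairing Φ e h (s : E [⋀^Fin k]→L[ℝ] ℂ))).toAddSubgroup) →ₗ[ℤ]
        ↥(integralForms Φ' l ⊓ ⨅ s : integralHodgeClassesIn Φ' k p,
          (LinearMap.ker (poincarePairing Φ' e' h (s : E' [⋀^Fin k]→L[ℝ] ℂ))).toAddSubgroup))
    (hG : ∀ x (β : E' [⋀^Fin k]→L[ℝ] ℂ), poincarePairing Φ' e' h β (G x : E' [⋀^Fin l]→L[ℝ] ℂ) =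
      poincarePairing Φ e h (β.compContinuousLinearMap (realRep Φ Φ' A)) (x : E [⋀^Fin l]→L[ℝ] ℂ)) :
    ((integralForms Φ' l ⊓ ⨅ s : integralHodgeClassesIn Φ' k p,
          (LinearMap.ker (poincarePairing Φ' e' h (s : E' [⋀^Fin k]→L[ℝ] ℂ))).toAddSubgroup).map
        (pullbackAlt (realRep Φ Φ' A) l).toAddMonoidHom).relIndex
      (integralForms Φ l ⊓ ⨅ s : integralHodgeClassesIn Φ k p,
          (LinearMap.ker (poincarePairing Φ e h (s : E [⋀^Fin k]→L[ℝ] ℂ))).toAddSubgroup) *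
      (LinearMap.range G).toAddSubgroup.index =
    (A.submatrix ((finCongr h).trans e') ((finCongr h).trans e)).det.natAbs ^
      finrank ℤ ↥(integralForms Φ l ⊓ ⨅ s : integralHodgeClassesIn Φ k p,
          (LinearMap.ker (poincarePairing Φ e h (s : E [⋀^Fin k]→L[ℝ] ℂ))).toAddSubgroup) := by
  obtain ⟨R, hR, hRinj⟩ := hf.exists_intLinearMap_integralHodgeAnnihilator_injective Φ Φ' e e' h p (k := k) (l := l)
  haveI := moduleFree_integralHodgeAnnihilator Φ e h p (k := k) (l := l)
  haveI := moduleFinite_integralHodgeAnnihilator Φ e h p (k := k) (l := l)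
  rw [AddSubgroup.relIndex, ← range_toAddSubgroup_eq_addSubgroupOf_map_pullbackAlt Φ Φ' e e' h p A R hR]
  exact index_range_mul_index_range_eq_natAbs_pow_of_comp_eq_smul R G hRinj _
    (hf.pullback_gysin_apply_eq_det_smul Φ Φ' e e' h p R hR G hG)

/-- **`[T_{X′} : f_! T_X]` divides `|det(A_{ẽ′ẽ})|^{rk T_X}`** (from the index product). [cite: Bredon1993, Ch. VI §14 Prop. 14.1 (6)] [cite: VoisinHodgeI2002, §7.3.2 Remark 7.29] -/
theorem IsIsogeny.index_range_gysin_dvd {A : Matrix ι' ι ℤ} (hf : IsIsogeny Φ Φ' A)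
    (G : ↥(integralForms Φ l ⊓ ⨅ s : integralHodgeClassesIn Φ k p,
          (LinearMap.ker (poincarePairing Φ e h (s : E [⋀^Fin k]→L[ℝ] ℂ))).toAddSubgroup) →ₗ[ℤ]
        ↥(integralForms Φ' l ⊓ ⨅ s : integralHodgeClassesIn Φ' k p,
          (LinearMap.ker (poincarePairing Φ' e' h (s : E' [⋀^Fin k]→L[ℝ] ℂ))).toAddSubgroup))
    (hG : ∀ x (β : E' [⋀^Fin k]→L[ℝ] ℂ), poincarePairing Φ' e' h β (G x : E' [⋀^Fin l]→L[ℝ] ℂ) =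
      poincarePairing Φ e h (β.compContinuousLinearMap (realRep Φ Φ' A)) (x : E [⋀^Fin l]→L[ℝ] ℂ)) :
    (LinearMap.range G).toAddSubgroup.index ∣
      (A.submatrix ((finCongr h).trans e') ((finCongr h).trans e)).det.natAbs ^
        finrank ℤ ↥(integralForms Φ l ⊓ ⨅ s : integralHodgeClassesIn Φ k p,
          (LinearMap.ker (poincarePairing Φ e h (s : E [⋀^Fin k]→L[ℝ] ℂ))).toAddSubgroup) :=
  Dvd.intro_left _ (hf.relIndex_map_pullbackAlt_mul_index_range_gysin_eq Φ Φ' e e' h p G hG)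

/-- **`[T_{X′} : f_! T_X]` is finite (non-zero)** for an isogeny: the Gysin image of the transcendental lattice has finite index in the
transcendental lattice of the target. [cite: VoisinHodgeI2002, §7.3.2 Remark 7.29] [cite: Huybrechts2016K3, Ch. 14 §0.1 (PDF p. 333)] -/
theorem IsIsogeny.index_range_gysin_ne_zero {A : Matrix ι' ι ℤ} (hf : IsIsogeny Φ Φ' A)
    (G : ↥(integralForms Φ l ⊓ ⨅ s : integralHodgeClassesIn Φ k p,
          (LinearMap.ker (poincarePairing Φ e h (s : E [⋀^Fin k]→L[ℝ] ℂ))).toAddSubgroup) →ₗ[ℤ]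
        ↥(integralForms Φ' l ⊓ ⨅ s : integralHodgeClassesIn Φ' k p,
          (LinearMap.ker (poincarePairing Φ' e' h (s : E' [⋀^Fin k]→L[ℝ] ℂ))).toAddSubgroup))
    (hG : ∀ x (β : E' [⋀^Fin k]→L[ℝ] ℂ), poincarePairing Φ' e' h β (G x : E' [⋀^Fin l]→L[ℝ] ℂ) =
      poincarePairing Φ e h (β.compContinuousLinearMap (realRep Φ Φ' A)) (x : E [⋀^Fin l]→L[ℝ] ℂ)) :
    (LinearMap.range G).toAddSubgroup.index ≠ 0 := fun h0 ↦ by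
  have h1 := hf.index_range_gysin_dvd Φ Φ' e e' h p G hG
  rw [h0, zero_dvd_iff] at h1
  exact pow_ne_zero _ (Int.natAbs_ne_zero.2 (hf.det_submatrix_finCongr_ne_zero Φ Φ' e e' h)) h1

/-- **`f_!|_T : T_X → T_{X′}` is injective for an isogeny** (`f^* ∘ f_! = det · id` with `det ≠ 0` on the torsion-free `T_X`).
[cite: VoisinHodgeI2002, §7.3.2 Remark 7.29 (`φ_* ∘ φ^* = d Id`)] [cite: Bredon1993, Ch. VI §14 Prop. 14.1 (7)] -/
theorem IsIsogeny.gysin_injective {A : Matrix ι' ι ℤ} (hf : IsIsogeny Φ Φ' A)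
    (G : ↥(integralForms Φ l ⊓ ⨅ s : integralHodgeClassesIn Φ k p,
          (LinearMap.ker (poincarePairing Φ e h (s : E [⋀^Fin k]→L[ℝ] ℂ))).toAddSubgroup) →ₗ[ℤ]
        ↥(integralForms Φ' l ⊓ ⨅ s : integralHodgeClassesIn Φ' k p,
          (LinearMap.ker (poincarePairing Φ' e' h (s : E' [⋀^Fin k]→L[ℝ] ℂ))).toAddSubgroup))
    (hG : ∀ x (β : E' [⋀^Fin k]→L[ℝ] ℂ), poincarePairing Φ' e' h β (G x : E' [⋀^Fin l]→L[ℝ] ℂ) =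
      poincarePairing Φ e h (β.compContinuousLinearMap (realRep Φ Φ' A)) (x : E [⋀^Fin l]→L[ℝ] ℂ)) :
    Injective G := by
  obtain ⟨R, hR, -⟩ := hf.exists_intLinearMap_integralHodgeAnnihilator_injective Φ Φ' e e' h p (k := k) (l := l)
  intro x y hxy
  have h1 := hf.pullback_gysin_apply_eq_det_smul Φ Φ' e e' h p R hR G hG x
  have h2 := hf.pullback_gysin_apply_eq_det_smul Φ Φ' e e' h p R hR G hG y
  rw [hxy, h2] at h1
  -- `det • y = det • x` on forms
  have h3 := congrArg (fun z : ↥(integralForms Φ l ⊓ ⨅ s : integralHodgeClassesIn Φ k p,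
      (LinearMap.ker (poincarePairing Φ e h (s : E [⋀^Fin k]→L[ℝ] ℂ))).toAddSubgroup) ↦ (z : E [⋀^Fin l]→L[ℝ] ℂ)) h1
  simp only [AddSubgroupClass.coe_zsmul, ← Int.cast_smul_eq_zsmul ℂ] at h3
  exact Subtype.ext ((smul_right_injective _ (Int.cast_ne_zero.2
    (hf.det_submatrix_finCongr_ne_zero Φ Φ' e e' h))) h3).symm

/-- **`f_! T_X = T_{X′}` iff `[T_X : f^* T_{X′}]` is as large as possible, `= |det(A_{ẽ′ẽ})|^{rk T_X}`** (the index product).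
[cite: Bredon1993, Ch. VI §14 Prop. 14.1 (6)–(7)] [cite: Fulton1998, Example 1.7.4 (p. 31)] -/
theorem IsIsogeny.range_gysin_eq_top_iff {A : Matrix ι' ι ℤ} (hf : IsIsogeny Φ Φ' A)
    (G : ↥(integralForms Φ l ⊓ ⨅ s : integralHodgeClassesIn Φ k p,
          (LinearMap.ker (poincarePairing Φ e h (s : E [⋀^Fin k]→L[ℝ] ℂ))).toAddSubgroup) →ₗ[ℤ]
        ↥(integralForms Φ' l ⊓ ⨅ s : integralHodgeClassesIn Φ' k p,
          (LinearMap.ker (poincarePairing Φ' e' h (s : E' [⋀^Fin k]→L[ℝ] ℂ))).toAddSubgroup))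
    (hG : ∀ x (β : E' [⋀^Fin k]→L[ℝ] ℂ), poincarePairing Φ' e' h β (G x : E' [⋀^Fin l]→L[ℝ] ℂ) =
      poincarePairing Φ e h (β.compContinuousLinearMap (realRep Φ Φ' A)) (x : E [⋀^Fin l]→L[ℝ] ℂ)) :
    LinearMap.range G = ⊤ ↔
      ((integralForms Φ' l ⊓ ⨅ s : integralHodgeClassesIn Φ' k p,
          (LinearMap.ker (poincarePairing Φ' e' h (s : E' [⋀^Fin k]→L[ℝ] ℂ))).toAddSubgroup).map
        (pullbackAlt (realRep Φ Φ' A) l).toAddMonoidHom).relIndex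
      (integralForms Φ l ⊓ ⨅ s : integralHodgeClassesIn Φ k p,
          (LinearMap.ker (poincarePairing Φ e h (s : E [⋀^Fin k]→L[ℝ] ℂ))).toAddSubgroup) =
    (A.submatrix ((finCongr h).trans e') ((finCongr h).trans e)).det.natAbs ^
      finrank ℤ ↥(integralForms Φ l ⊓ ⨅ s : integralHodgeClassesIn Φ k p,
          (LinearMap.ker (poincarePairing Φ e h (s : E [⋀^Fin k]→L[ℝ] ℂ))).toAddSubgroup) := by
  have hprod := hf.relIndex_map_pullbackAlt_mul_index_range_gysin_eq Φ Φ' e e' h p G hG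
  have hne := hf.index_range_gysin_ne_zero Φ Φ' e e' h p G hG
  constructor
  · intro htop
    rw [htop, Submodule.top_toAddSubgroup, AddSubgroup.index_top, mul_one] at hprod
    exact hprod
  · intro hidx
    rw [hidx] at hprod
    have h1 : (LinearMap.range G).toAddSubgroup.index = 1 := by
      have hpos : 0 < (A.submatrix ((finCongr h).trans e') ((finCongr h).trans e)).det.natAbs ^
          finrank ℤ ↥(integralForms Φ l ⊓ ⨅ s : integralHodgeClassesIn Φ k p,
            (LinearMap.ker (poincarePairing Φ e h (s : E [⋀^Fin k]→L[ℝ] ℂ))).toAddSubgroup) :=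
        pow_pos (Int.natAbs_pos.2 (hf.det_submatrix_finCongr_ne_zero Φ Φ' e e' h)) _
      exact Nat.eq_of_mul_eq_mul_left hpos (by rw [mul_one]; exact hprod)
    rw [← Submodule.toAddSubgroup_inj, Submodule.top_toAddSubgroup]
    exact AddSubgroup.index_eq_one.1 h1

end GysinIndex

end Literature.Geometry.Kaehler.ComplexTorus
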